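import Literature.Computability.AlgebraicComplexity.SymmetricDenseSubtraction
import Mathlib.Algebra.BigOperators.Fin
import Mathlib.Tactic.LinearCombination
import HarnessLib

/-!
# Symmetric circuits: subtracting the dense universal polynomial (semantics and symmetry)

Topic `Computability/AlgebraicComplexity`, namespace `Literature.Computability.AlgebraicComplexity`.
Continuation of `SymmetricDenseSubtraction.lean` (the circuit `LabelledArithCircuit.DenseSub.circuit`
built on a Dawar–Wilsenach labelled circuit `C` computing `(1 + Σ_x x)^d + e·p`):

* SEMANTICS (`eval_old`, …, `eval_output`): old gates keep their values, `lin k` computes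
  `1 + Σ_x x`, `pow` computes `U = (1 + Σ_x x)^d`, and the output computes
  `(out_C - U) e⁻¹ = p` when `e ≠ 0`;
* SYMMETRY (`isSymmetric_circuit`): an automorphism `π` of `C` extending `γ ∈ Γ` (Def. 3.6 of
  A. Dawar, G. Wilsenach, *Symmetric Arithmetic Circuits*, Theory of Computing 21 (2025)) extends
  to the new circuit — old gates move by `π`, the new variable gates by `γ` (a variable has an
  input gate in `C` iff its `γ`-translate has, `exists_label_var_smul_iff`), everything else is
  fixed; so a `Γ`-symmetric `C` (Def. 3.7) gives a `Γ`-symmetric subtraction circuit, for every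
  group `Γ` acting on the variables;
* SIZE (`card_gate_le`): at most `|C| + |X| + d + 7` gates;
* the packaged statement `LabelledArithCircuit.IsSymmetric.exists_sub_dense`.

This is the symmetric-circuit form of the remark after Thm. 1 of P. Hrubeš, *On ε-sensitive
monotone computations*, Comput. Complexity 29 (2020) ("`f = (g_ε - U) ε⁻¹` has a small
arithmetic circuit"). Everything is folklore and proved; nothing here is a named fact.
-/

noncomputable section

open scoped Classical

namespace Literature.Computability.AlgebraicComplexity

open MvPolynomial

universe u v w

namespace LabelledArithCircuit

namespace DenseSub

variable {K : Type u} [Field K] {X : Type v} [Fintype X] {G : Type w}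
  {C : LabelledArithCircuit K X Unit G} {d : ℕ} {e : K}

/-! ### Semantics -/

/-- Old gates keep their values. [folklore] -/
theorem eval_old (g : G) : (circuit C d e).eval (.old g) = C.eval g := by
  induction g using C.wf.induction with
  | h g ih =>
    rw [(circuit C d e).eval_eq, C.eval_eq g]
    change (match label C d e (.old g) with
      | .var x => MvPolynomial.X x
      | .const c => MvPolynomial.C c
      | .add => ∑ h ∈ children C d e (.old g), (circuit C d e).eval h
      | .mul => ∏ h ∈ children C d e (.old g), (circuit C d e).eval h) = _
    simp only [label, children]
    rcases C.label g with x | c | _ | _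
    · rfl
    · rfl
    · simp only [Finset.sum_map, DenseSubGate.oldEmb_apply]
      exact Finset.sum_congr rfl fun h hh => ih h hh
    · simp only [Finset.prod_map, DenseSubGate.oldEmb_apply]
      exact Finset.prod_congr rfl fun h hh => ih h hh

/-- Variable sources compute their variable. [folklore] -/
theorem eval_vsrc (x : X) : (circuit C d e).eval (vsrc x) = MvPolynomial.X x :=
  (circuit C d e).eval_of_label_var (label_vsrc x)

/-- Constant sources compute their constant. [folklore] -/
theorem eval_csrc (c : K) (hc : c ∈ cset e) :
    (circuit C d e).eval (csrc c hc) = MvPolynomial.C c :=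
  (circuit C d e).eval_of_label_const (label_csrc c hc)

/-- `lin k` computes `1 + Σ_x x`. [folklore] -/
theorem eval_lin (k : Fin d) :
    (circuit C d e).eval (.lin k) = 1 + ∑ x : X, MvPolynomial.X x := by
  rw [(circuit C d e).eval_of_label_add (show (circuit C d e).label (.lin k) = .add from rfl)]
  change ∑ h ∈ insert (csrc 1 (mem_cset e).1) (Finset.univ.image vsrc), _ = _
  rw [Finset.sum_insert, Finset.sum_image (fun x _ y _ h => vsrc_injective h), eval_csrc,
    MvPolynomial.C_1]
  · simp only [eval_vsrc]
  · simp only [Finset.mem_image, Finset.mem_univ, true_and, not_exists]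
    exact fun x hx => csrc_ne_vsrc _ _ x hx.symm

/-- `pow` computes `U = (1 + Σ_x x)^d`. [folklore] -/
theorem eval_pow : (circuit C d e).eval .pow = (1 + ∑ x : X, MvPolynomial.X x) ^ d := by
  rw [(circuit C d e).eval_of_label_mul (show (circuit C d e).label .pow = .mul from rfl)]
  change ∏ h ∈ insert (csrc 1 (mem_cset e).1) (Finset.univ.image DenseSubGate.lin), _ = _
  rw [Finset.prod_insert, Finset.prod_image (fun x _ y _ h => DenseSubGate.lin_injective h),
    eval_csrc, MvPolynomial.C_1, one_mul]
  · simp only [eval_lin, Finset.prod_const, Finset.card_univ, Fintype.card_fin]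
  · simp only [Finset.mem_image, Finset.mem_univ, true_and, not_exists]
    exact fun k hk => csrc_ne_of_ne _ _ (by simp) (by simp) hk.symm

/-- `neg` computes `-U`. [folklore] -/
theorem eval_neg :
    (circuit C d e).eval .neg = (1 + ∑ x : X, MvPolynomial.X x) ^ d * MvPolynomial.C (-1) := by
  rw [(circuit C d e).eval_of_label_mul (show (circuit C d e).label .neg = .mul from rfl)]
  change ∏ h ∈ ({DenseSubGate.pow, csrc (-1) (mem_cset e).2.1} : Finset (Gate C d e)), _ = _
  rw [Finset.prod_pair (csrc_ne_of_ne _ _ (by simp) (by simp)).symm, eval_pow, eval_csrc]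

/-- `dif` computes `out_C - U`. [folklore] -/
theorem eval_dif :
    (circuit C d e).eval .dif =
      C.eval (C.output ()) + (1 + ∑ x : X, MvPolynomial.X x) ^ d * MvPolynomial.C (-1) := by
  rw [(circuit C d e).eval_of_label_add (show (circuit C d e).label .dif = .add from rfl)]
  change ∑ h ∈ ({DenseSubGate.old (C.output ()), DenseSubGate.neg} : Finset (Gate C d e)), _ = _
  rw [Finset.sum_pair (by simp), eval_old, eval_neg]

/-- The output computes `(out_C - U) e⁻¹`. [folklore] -/
theorem eval_out :
    (circuit C d e).eval .out =
      (C.eval (C.output ()) + (1 + ∑ x : X, MvPolynomial.X x) ^ d * MvPolynomial.C (-1)) *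
        MvPolynomial.C e⁻¹ := by
  rw [(circuit C d e).eval_of_label_mul (show (circuit C d e).label .out = .mul from rfl)]
  change ∏ h ∈ ({DenseSubGate.dif, csrc e⁻¹ (mem_cset e).2.2} : Finset (Gate C d e)), _ = _
  rw [Finset.prod_pair (csrc_ne_of_ne _ _ (by simp) (by simp)).symm, eval_dif, eval_csrc]

/-- **Semantics.** If `C` computes `(1 + Σ_x x)^d + e·p` with `e ≠ 0`, the subtraction circuit
computes `p`. [folklore] -/
theorem eval_output (he : e ≠ 0) {p : MvPolynomial X K}
    (heval : C.eval (C.output ()) = (1 + ∑ x : X, MvPolynomial.X x) ^ d + MvPolynomial.C e * p) :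
    (circuit C d e).eval ((circuit C d e).output ()) = p := by
  change (circuit C d e).eval .out = p
  rw [eval_out, heval]
  have h1 : (MvPolynomial.C e : MvPolynomial X K) * MvPolynomial.C e⁻¹ = 1 := by
    rw [← MvPolynomial.C_mul, mul_inv_cancel₀ he, MvPolynomial.C_1]
  have h2 : (MvPolynomial.C (-1 : K) : MvPolynomial X K) = -1 := by
    rw [MvPolynomial.C_neg, MvPolynomial.C_1]
  rw [h2]
  linear_combination p * h1

/-! ### Symmetry -/

section Symmetry

variable {Γ : Type*} [Group Γ] [MulAction Γ X] {γ : Γ} {π : Equiv.Perm G}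

omit [Field K] [Fintype X] in
/-- Along an automorphism of `C` extending `γ`, the variable `γ • x` has an input gate in `C` iff
`x` has one (Dawar–Wilsenach Def. 3.6: input gates labelled `x` go to input gates labelled `γ x`).
[folklore] -/
theorem exists_label_var_smul_iff (hπ : C.IsAutomorphismExtending γ π) (x : X) :
    (∃ g, C.label g = .var (γ • x)) ↔ ∃ g, C.label g = .var x := by
  constructor
  · rintro ⟨g, hg⟩
    have h1 := hπ.label_apply (π.symm g)
    rw [Equiv.apply_symm_apply, hg] at h1
    rcases h0 : C.label (π.symm g) with y | c | _ | _
    · rw [h0, CircuitLabel.smul_var, CircuitLabel.var.injEq] at h1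
      exact ⟨π.symm g, by rw [h0, smul_left_cancel γ h1]⟩
    all_goals rw [h0] at h1; simp at h1
  · rintro ⟨g, hg⟩
    exact ⟨π g, by rw [hπ.label_apply, hg, CircuitLabel.smul_var]⟩

/-- The permutation of the new variable gates induced by `γ` along an automorphism of `C`.
[folklore] -/
def permNV (hπ : C.IsAutomorphismExtending γ π) : Equiv.Perm (NV C) :=
  (MulAction.toPerm γ : Equiv.Perm X).subtypeEquiv fun x => by
    simp only [MulAction.toPerm_apply, ne_eq, ← not_exists]
    exact not_congr (exists_label_var_smul_iff hπ x).symm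

/-- The extension of an automorphism `π` of `C` to the subtraction circuit. [folklore] -/
def perm (hπ : C.IsAutomorphismExtending γ π) : Equiv.Perm (Gate C d e) :=
  DenseSubGate.perm π (permNV hπ)

omit [Fintype X] in
/-- Constant sources are fixed by the extended automorphism. [folklore] -/
theorem perm_csrc (hπ : C.IsAutomorphismExtending γ π) (c : K) (hc : c ∈ cset e) :
    perm (d := d) (e := e) hπ (csrc c hc) = csrc c hc := by
  unfold csrc
  split_ifs with h
  · change DenseSubGate.old (π h.choose) = DenseSubGate.old h.choose
    rw [hπ.apply_eq_self_of_label_const h.choose_spec]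
  · rfl

omit [Fintype X] in
/-- The extended automorphism carries the source of `x` to the source of `γ • x`. [folklore] -/
theorem perm_vsrc (hπ : C.IsAutomorphismExtending γ π) (x : X) :
    perm (d := d) (e := e) hπ (vsrc x) = vsrc (γ • x) := by
  by_cases hx : ∃ g, C.label g = .var x
  · have hx' : ∃ g, C.label g = .var (γ • x) := (exists_label_var_smul_iff hπ x).2 hx
    have h1 : (vsrc x : Gate C d e) = .old hx.choose := by unfold vsrc; rw [dif_pos hx]
    have h2 : (vsrc (γ • x) : Gate C d e) = .old hx'.choose := by unfold vsrc; rw [dif_pos hx']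
    rw [h1, h2]
    change DenseSubGate.old (π hx.choose) = DenseSubGate.old hx'.choose
    congr 1
    refine C.eq_of_label_eq _ _ (by rw [hπ.label_apply, hx.choose_spec]; simp) ?_
    rw [hπ.label_apply, hx.choose_spec, hx'.choose_spec, CircuitLabel.smul_var]
  · have hx' : ¬ ∃ g, C.label g = .var (γ • x) :=
      fun h => hx ((exists_label_var_smul_iff hπ x).1 h)
    have h1 : (vsrc x : Gate C d e) = .nvar ⟨x, not_exists.mp hx⟩ := by
      unfold vsrc; rw [dif_neg hx]
    have h2 : (vsrc (γ • x) : Gate C d e) = .nvar ⟨γ • x, not_exists.mp hx'⟩ := by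
      unfold vsrc; rw [dif_neg hx']
    rw [h1, h2]
    rfl

/-- The set of variable sources is stable under the extended automorphism. [folklore] -/
theorem image_vsrc_map_perm (hπ : C.IsAutomorphismExtending γ π) :
    ((Finset.univ : Finset X).image (vsrc : X → Gate C d e)).map (perm hπ).toEmbedding =
      (Finset.univ : Finset X).image vsrc := by
  rw [Finset.map_eq_image, Finset.image_image]
  have h : ((perm (d := d) (e := e) hπ).toEmbedding : Gate C d e → Gate C d e) ∘ vsrc =
      vsrc ∘ fun x : X => γ • x := by
    funext x; exact perm_vsrc hπ x
  rw [h, ← Finset.image_image, Finset.image_univ_of_surjective (MulAction.surjective γ)]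

/-- **Symmetry.** The extension of an automorphism of `C` extending `γ` is an automorphism of
the subtraction circuit extending `γ`. [folklore] -/
theorem isAutomorphismExtending_perm (hπ : C.IsAutomorphismExtending γ π) :
    (circuit C d e).IsAutomorphismExtending γ (perm hπ) := by
  refine ⟨fun a => ?_, fun a => ?_, fun y => rfl⟩
  · cases a with
    | old g =>
      change (C.children (π g)).map DenseSubGate.oldEmb =
        ((C.children g).map DenseSubGate.oldEmb).map (perm hπ).toEmbedding
      rw [hπ.children_apply, Finset.map_map, Finset.map_map]
      rfl
    | nvar x => exact (Finset.map_empty _).symm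
    | ncst c => exact (Finset.map_empty _).symm
    | lin k =>
      change insert (csrc 1 (mem_cset e).1) (Finset.univ.image vsrc) =
        (insert (csrc 1 (mem_cset e).1) (Finset.univ.image vsrc)).map (perm hπ).toEmbedding
      rw [Finset.map_insert, image_vsrc_map_perm, Equiv.coe_toEmbedding, perm_csrc]
    | pow =>
      change insert (csrc 1 (mem_cset e).1) (Finset.univ.image DenseSubGate.lin) =
        (insert (csrc 1 (mem_cset e).1) (Finset.univ.image DenseSubGate.lin)).map
          (perm hπ).toEmbedding
      rw [Finset.map_insert, Finset.map_eq_image, Finset.image_image, Equiv.coe_toEmbedding,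
        perm_csrc]
      rfl
    | neg =>
      change ({DenseSubGate.pow, csrc (-1) (mem_cset e).2.1} : Finset (Gate C d e)) =
        ({DenseSubGate.pow, csrc (-1) (mem_cset e).2.1} : Finset (Gate C d e)).map
          (perm hπ).toEmbedding
      rw [Finset.map_insert, Finset.map_singleton, Equiv.coe_toEmbedding, perm_csrc]
      rfl
    | dif =>
      change ({DenseSubGate.old (C.output ()), DenseSubGate.neg} : Finset (Gate C d e)) =
        ({DenseSubGate.old (C.output ()), DenseSubGate.neg} : Finset (Gate C d e)).map
          (perm hπ).toEmbedding
      rw [Finset.map_insert, Finset.map_singleton, Equiv.coe_toEmbedding]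
      change _ = insert (DenseSubGate.old (π (C.output ()))) {DenseSubGate.neg}
      rw [← hπ.output_smul ()]
    | out =>
      change ({DenseSubGate.dif, csrc e⁻¹ (mem_cset e).2.2} : Finset (Gate C d e)) =
        ({DenseSubGate.dif, csrc e⁻¹ (mem_cset e).2.2} : Finset (Gate C d e)).map
          (perm hπ).toEmbedding
      rw [Finset.map_insert, Finset.map_singleton, Equiv.coe_toEmbedding, perm_csrc]
      rfl
  · cases a with
    | old g => exact hπ.label_apply g
    | _ => rfl

/-- A `Γ`-symmetric `C` gives a `Γ`-symmetric subtraction circuit. [folklore] -/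
theorem isSymmetric_circuit (hsym : C.IsSymmetric Γ) : (circuit C d e).IsSymmetric Γ := by
  intro γ
  obtain ⟨π, hπ⟩ := hsym γ
  exact ⟨perm hπ, isAutomorphismExtending_perm hπ⟩

end Symmetry

/-! ### Size and the packaged statement -/

omit [Field K] in
/-- `|NV| ≤ |X|`. [folklore] -/
theorem card_NV_le : Fintype.card (NV C) ≤ Fintype.card X := by
  unfold NV; exact Fintype.card_subtype_le _

omit [Fintype X] in
/-- `|NC| ≤ 3`. [folklore] -/
theorem card_NC_le : Fintype.card (NC C e) ≤ 3 := by
  calc Fintype.card (NC C e) = ((cset e).filter fun c => ∀ g, C.label g ≠ .const c).card :=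
        Fintype.subtype_card _ _
    _ ≤ (cset e).card := Finset.card_filter_le _ _
    _ ≤ 3 := Finset.card_le_three

/-- **Size.** The subtraction circuit has at most `|G| + |X| + d + 7` gates. [folklore] -/
theorem card_gate_le [Fintype G] :
    Fintype.card (Gate C d e) ≤ Fintype.card G + Fintype.card X + d + 7 := by
  rw [Fintype.card_congr DenseSubGate.equivSum]
  simp only [Fintype.card_sum, Fintype.card_fin]
  have h1 := card_NV_le (C := C)
  have h2 := card_NC_le (C := C) (e := e)
  omega

end DenseSub

/-- **Symmetric subtraction of the dense universal polynomial.** For any group `Γ` acting on the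
(finitely many) variables `X`: a `Γ`-symmetric labelled circuit over a field computing
`(1 + Σ_x x)^d + e·p` with `e ≠ 0` yields a `Γ`-symmetric labelled circuit computing `p` with at
most `|X| + d + 7` more gates (the symmetric-circuit form of the remark after Hrubeš 2020,
Thm. 1). [folklore] -/
theorem IsSymmetric.exists_sub_dense {K : Type u} [Field K] {X : Type v} [Fintype X] {G : Type w}
    [Fintype G] {C : LabelledArithCircuit K X Unit G} {Γ : Type*} [Group Γ] [MulAction Γ X]
    (hsym : C.IsSymmetric Γ) (d : ℕ) {e : K} (he : e ≠ 0) (p : MvPolynomial X K)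
    (heval : C.eval (C.output ()) = (1 + ∑ x : X, MvPolynomial.X x) ^ d + MvPolynomial.C e * p) :
    ∃ (G' : Type (max u v w)) (_ : Fintype G') (C' : LabelledArithCircuit K X Unit G'),
      C'.IsSymmetric Γ ∧ C'.eval (C'.output ()) = p ∧
        Fintype.card G' ≤ Fintype.card G + Fintype.card X + d + 7 :=
  ⟨DenseSub.Gate C d e, inferInstance, DenseSub.circuit C d e, DenseSub.isSymmetric_circuit hsym,
    DenseSub.eval_output he heval, DenseSub.card_gate_le⟩

end LabelledArithCircuit

end Literature.Computability.AlgebraicComplexity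

end
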